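import Summits.BirchSwinnertonDyer.BirchSwinnertonDyer.Theorems.Rank2Observatory2DescClCurveCertE2Defs
import HarnessLib

/-!
# BirchSwinnertonDyer — rank ≥ 2 observatory: KERNEL-2DESC-CL v2.3 — the TWO-VIEW per-curve certificate (complex case), part 2/4: element-level soundness

HONEST FRAMING: per-curve certified theorems and census instruments; no claim on BSD in rank ≥ 2.

Part 2 of 4 (split at the 400-line module cap; text verbatim).  The `𝓞 K` element `eltOf` of a two-view pair and its
norm / real-place / multiplier identities; the entry-level consequences of `famCheckE2`; soundness of the per-prime
dispatch (`dispatch_sound`), the support-code clause, the support of a family element (`supp_of_famCheckE2`), sign and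
real non-vanishing.  Sorry-free; axioms `propext`, `Classical.choice`, `Quot.sound`.
[cite: Cassels1991LecturesEllipticCurves, §15] [cite: CremonaAlgorithms1997, §3.6] [cite: Cohen1993, §4.8.2, §6.2, §6.5]
[cite: SilvermanAEC2009, X.1.1]
-/

set_option linter.dupNamespace false

noncomputable section

open scoped Classical NumberField nonZeroDivisors

open Literature.NumberTheory.NumberFields Polynomial Module NumberField IsDedekindDomain Ideal

namespace Summit.BirchSwinnertonDyer.BirchSwinnertonDyer.Rank2Observatory.TwoDescCl

open TwoDescCubic ClFieldCert

/-! ## Soundness -/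

section Sound

variable {K : Type*} [Field K] [NumberField K] {θ : K} (F : ClFieldCertE2)

/-- The `𝓞 K` element of a two-view pair. -/
def eltOf (hθ : aeval θ (MonicCubic.poly F.fe.base.a F.fe.base.b F.fe.base.c) = 0) (hE : F.fe.checkCoreE = true)
    (X Y : ℤ × ℤ × ℤ) : 𝓞 K :=
  twoViewElt hθ (F.fe.aeval_eta hθ hE) F.s F.t X Y

variable {F}

/-- `m₁ · x = X(α)` in `𝓞 K`. -/
theorem m₁_mul_eltOf (hθ : aeval θ (MonicCubic.poly F.fe.base.a F.fe.base.b F.fe.base.c) = 0)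
    (hE : F.fe.checkCoreE = true) (hK : F.checkConst = true) {X Y : ℤ × ℤ × ℤ}
    (h : twoViewCheck F.fe.base.a F.fe.base.b F.fe.base.c F.fe.u F.fe.d F.m₁ F.m₂ X Y = true) :
    (F.m₁ : 𝓞 K) * eltOf F hθ hE X Y = lin hθ X.1 X.2.1 X.2.2 :=
  natCast_mul_twoViewElt_alpha hθ (F.fe.d_pos hE) (F.fe.aeval_eta hθ hE) (F.bezout_of_const hK) h

/-- `m₂ · x = Y(η)` in `𝓞 K`. -/
theorem m₂_mul_eltOf (hθ : aeval θ (MonicCubic.poly F.fe.base.a F.fe.base.b F.fe.base.c) = 0)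
    (hE : F.fe.checkCoreE = true) (hK : F.checkConst = true) {X Y : ℤ × ℤ × ℤ}
    (h : twoViewCheck F.fe.base.a F.fe.base.b F.fe.base.c F.fe.u F.fe.d F.m₁ F.m₂ X Y = true) :
    (F.m₂ : 𝓞 K) * eltOf F hθ hE X Y = lin (F.fe.aeval_eta hθ hE) Y.1 Y.2.1 Y.2.2 :=
  natCast_mul_twoViewElt_eta hθ (F.fe.d_pos hE) (F.fe.aeval_eta hθ hE) (F.bezout_of_const hK) h

/-- `m₁ · x = X(α)` in `K`. -/
theorem m₁_mul_eltOf_coe (hθ : aeval θ (MonicCubic.poly F.fe.base.a F.fe.base.b F.fe.base.c) = 0)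
    (hE : F.fe.checkCoreE = true) (hK : F.checkConst = true) {X Y : ℤ × ℤ × ℤ}
    (h : twoViewCheck F.fe.base.a F.fe.base.b F.fe.base.c F.fe.u F.fe.d F.m₁ F.m₂ X Y = true) :
    (F.m₁ : K) * algebraMap (𝓞 K) K (eltOf F hθ hE X Y) = algebraMap (𝓞 K) K (lin hθ X.1 X.2.1 X.2.2) :=
  coe_twoViewElt_alpha hθ (F.fe.d_pos hE) (F.fe.aeval_eta hθ hE) (F.bezout_of_const hK) h

/-- `(m₁ : K) ≠ 0`. -/
theorem m₁_ne_zero_K (hK : F.checkConst = true) : (F.m₁ : K) ≠ 0 := Nat.cast_ne_zero.mpr (F.m₁_pos hK).ne'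

/-- `(m₁ : 𝓞 K) ≠ 0`. -/
theorem m₁_ne_zero_O (hK : F.checkConst = true) : (F.m₁ : 𝓞 K) ≠ 0 := Nat.cast_ne_zero.mpr (F.m₁_pos hK).ne'

/-- A two-view element with non-zero `α`-norm form is non-zero. -/
theorem eltOf_ne_zero (hθ : aeval θ (MonicCubic.poly F.fe.base.a F.fe.base.b F.fe.base.c) = 0)
    (h3 : finrank ℚ K = 3) (hE : F.fe.checkCoreE = true) (hK : F.checkConst = true) {X Y : ℤ × ℤ × ℤ}
    (h : twoViewCheck F.fe.base.a F.fe.base.b F.fe.base.c F.fe.u F.fe.d F.m₁ F.m₂ X Y = true)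
    (hN : normFormZ F.fe.base.a F.fe.base.b F.fe.base.c X.1 X.2.1 X.2.2 ≠ 0) : eltOf F hθ hE X Y ≠ 0 := by
  intro h0
  have e := m₁_mul_eltOf hθ hE hK h
  rw [h0, mul_zero] at e
  exact lin_ne_zero_of_coords (F.fe.base.irreducible_of_reg (F.fe.checkReg_of_coreE hE)) hθ h3 X hN e.symm

/-- **Norm of a two-view element**: `N(x) = N(X) / m₁³`. [cite: Marcus2018, Ch. 2, Thm. 4] -/
theorem norm_eltOf (hθ : aeval θ (MonicCubic.poly F.fe.base.a F.fe.base.b F.fe.base.c) = 0)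
    (h3 : finrank ℚ K = 3) (hE : F.fe.checkCoreE = true) (hK : F.checkConst = true) {X Y : ℤ × ℤ × ℤ}
    (h : twoViewCheck F.fe.base.a F.fe.base.b F.fe.base.c F.fe.u F.fe.d F.m₁ F.m₂ X Y = true)
    (hdvd : ((F.m₁ : ℤ)) ^ 3 ∣ normFormZ F.fe.base.a F.fe.base.b F.fe.base.c X.1 X.2.1 X.2.2) :
    Algebra.norm ℚ (algebraMap (𝓞 K) K (eltOf F hθ hE X Y)) =
      ((normFormZ F.fe.base.a F.fe.base.b F.fe.base.c X.1 X.2.1 X.2.2 / (F.m₁ : ℤ) ^ 3 : ℤ) : ℚ) := by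
  have hirr := F.fe.base.irreducible_of_reg (F.fe.checkReg_of_coreE hE)
  have e := m₁_mul_eltOf_coe hθ hE hK h
  have hN := norm_lin_coords hirr hθ h3 X
  rw [RingOfIntegers.coe_eq_algebraMap, ← e, map_mul] at hN
  have hm : Algebra.norm ℚ ((F.m₁ : K)) = (F.m₁ : ℚ) ^ 3 := by
    rw [show ((F.m₁ : K)) = algebraMap ℚ K (F.m₁ : ℚ) by simp, Algebra.norm_algebraMap, h3]
  rw [hm] at hN
  have hm0 : ((F.m₁ : ℚ)) ^ 3 ≠ 0 := pow_ne_zero 3 (Nat.cast_ne_zero.mpr (F.m₁_pos hK).ne')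
  have hm0' : (((F.m₁ : ℤ) ^ 3 : ℤ) : ℚ) ≠ 0 := by push_cast; exact hm0
  rw [Int.cast_div hdvd hm0']
  push_cast
  rw [eq_div_iff hm0]
  linear_combination hN

/-- **Sign of a two-view element at a real place** (read on `X`, `m₁ > 0`). [folklore] -/
theorem rho_eltOf (hθ : aeval θ (MonicCubic.poly F.fe.base.a F.fe.base.b F.fe.base.c) = 0)
    (hE : F.fe.checkCoreE = true) (hK : F.checkConst = true) {X Y : ℤ × ℤ × ℤ}
    (h : twoViewCheck F.fe.base.a F.fe.base.b F.fe.base.c F.fe.u F.fe.d F.m₁ F.m₂ X Y = true) (ρ : K →+* ℝ) :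
    ρ ((lin hθ X.1 X.2.1 X.2.2 : 𝓞 K) : K) = (F.m₁ : ℝ) * ρ (algebraMap (𝓞 K) K (eltOf F hθ hE X Y)) := by
  rw [RingOfIntegers.coe_eq_algebraMap, ← m₁_mul_eltOf_coe hθ hE hK h, map_mul, map_natCast]

/-! ### Entry-level consequences of `famCheckE2` -/

variable {cc : ClCurveCertE2} {f : FamEntry2}

/-- The two-view clause of a checked family entry. -/
theorem tv_of_famCheckE2 (h : famCheckE2 F cc f = true) :
    twoViewCheck F.fe.base.a F.fe.base.b F.fe.base.c F.fe.u F.fe.d F.m₁ F.m₂ f.X f.Y = true := by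
  simp only [famCheckE2, Bool.and_eq_true] at h; exact h.1.1.1.1.1.1.1

/-- The sign clause of a checked family entry. -/
theorem signCond_of_famCheckE2 (h : famCheckE2 F cc f = true) :
    signCond F.fe.base.lo F.fe.base.hi f.X f.sg = true := by
  simp only [famCheckE2, Bool.and_eq_true] at h; exact h.1.1.1.1.1.1.2

/-- The norm form of `X` of a checked family entry is non-zero. -/
theorem normFormZ_ne_of_famCheckE2 (h : famCheckE2 F cc f = true) :
    normFormZ F.fe.base.a F.fe.base.b F.fe.base.c f.X.1 f.X.2.1 f.X.2.2 ≠ 0 := by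
  simp only [famCheckE2, Bool.and_eq_true, decide_eq_true_eq] at h; exact h.1.1.1.1.1.2

/-- The norm-divisibility clause of a checked family entry. -/
theorem dvd_of_famCheckE2 (h : famCheckE2 F cc f = true) :
    ((F.m₁ : ℤ)) ^ 3 ∣ normFormZ F.fe.base.a F.fe.base.b F.fe.base.c f.X.1 f.X.2.1 f.X.2.2 := by
  simp only [famCheckE2, Bool.and_eq_true, decide_eq_true_eq] at h; exact h.1.1.1.1.2

/-- The non-divisibility clause of a checked family entry at its support codes. -/
theorem not_dvd_evalInt_of_famCheckE2 (h : famCheckE2 F cc f = true) {ch : ℕ × ℤ × ℤ}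
    (hch : ch ∈ F.fe.base.chars) : ¬ (ch.1 : ℤ) ∣ evalInt ch.2.1 f.X := by
  simp only [famCheckE2, Bool.and_eq_true, List.all_eq_true, Bool.not_eq_true', decide_eq_false_iff_not] at h
  exact h.1.1.1.2 ch hch

/-- The absolute-norm clause of a checked family entry. -/
theorem natAbs_of_famCheckE2 (h : famCheckE2 F cc f = true) :
    (normFormZ F.fe.base.a F.fe.base.b F.fe.base.c f.X.1 f.X.2.1 f.X.2.2).natAbs =
      (f.nf.map fun pe => pe.1 ^ pe.2).prod := by
  simp only [famCheckE2, Bool.and_eq_true, decide_eq_true_eq] at h; exact h.1.1.2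

/-- The per-prime dispatch clause of a checked family entry. -/
theorem dispatch_of_famCheckE2 (h : famCheckE2 F cc f = true) :
    ∀ pe ∈ f.nf, primeDispatch F cc f.X f.Y f.invsA f.invsE pe.1 = true := by
  simp only [famCheckE2, Bool.and_eq_true, List.all_eq_true] at h; exact h.1.2

/-- The kind clause of a checked family entry. -/
theorem kind_of_famCheckE2 (h : famCheckE2 F cc f = true) : famKindCheck2 F f = true := by
  simp only [famCheckE2, Bool.and_eq_true] at h; exact h.2

/-! ### The prime dispatch is sound -/

/-- **Soundness of the prime dispatch**: if `x ∈ w`, `m₁x = X(α)`, `m₂x = Y(η)`, and a rational prime `l ∈ w`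
is dispatched, then `w` is `W₁`/`W₂`, or `w` is the prime of a support code, or we reach a contradiction.
Stated as: `w ∋ q`, or `w = idealOf (α) C` for a support `α`-code, or `w = idealOf (η) C` for a support `η`-code.
[folklore] -/
theorem dispatch_sound (hθ : aeval θ (MonicCubic.poly F.fe.base.a F.fe.base.b F.fe.base.c) = 0)
    (h3 : finrank ℚ K = 3) (hE : F.fe.checkCoreE = true) (hK : F.checkConst = true)
    (hpr : F.fe.primeListE.Forall Nat.Prime) {X Y : ℤ × ℤ × ℤ} {invsA invsE : List (PCode × (ℤ × ℤ × ℤ))}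
    {l : ℕ} (hdisp : primeDispatch F cc X Y invsA invsE l = true) (w : HeightOneSpectrum (𝓞 K))
    (hlw : (l : 𝓞 K) ∈ w.asIdeal) (hX : lin hθ X.1 X.2.1 X.2.2 ∈ w.asIdeal)
    (hY : lin (F.fe.aeval_eta hθ hE) Y.1 Y.2.1 Y.2.2 ∈ w.asIdeal) :
    ((F.fe.base.q : ℕ) : 𝓞 K) ∈ w.asIdeal ∨
      (∃ C, (true, C) ∈ cc.codes.map Prod.fst ∧ (F.fe.base.primes.any fun e => e.p == C.1) = true ∧
        C ∈ (F.fe.base.row C.1).codes ∧ w.asIdeal = idealOf hθ C ∧ (F.m₁ : 𝓞 K) ∉ w.asIdeal) ∨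
      (∃ C, (false, C) ∈ cc.codes.map Prod.fst ∧ (F.fe.primesE.any fun e => e.p == C.1) = true ∧
        C ∈ (F.fe.rowE C.1).codes ∧ w.asIdeal = idealOf (F.fe.aeval_eta hθ hE) C ∧
        (F.m₂ : 𝓞 K) ∉ w.asIdeal) := by
  have hR := F.fe.checkReg_of_coreE hE
  have hprb := F.fe.base_primeList hpr
  have hirr := F.fe.base.irreducible_of_reg hR
  simp only [primeDispatch, Bool.or_eq_true, Bool.and_eq_true, beq_iff_eq, List.all_eq_true, List.any_eq_true,
    decide_eq_true_eq] at hdisp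
  rcases hdisp with (rfl | ⟨hany, hall⟩) | ⟨hany, hall⟩
  · exact Or.inl hlw
  · have hany' : (F.fe.base.primes.any fun e => e.p == l) = true := by simpa [List.any_eq_true] using hany
    obtain ⟨hrow, hrowp⟩ := row_mem hany'
    have hpp : (F.fe.base.row l).p.Prime := F.fe.base.prime_of_mem hprb hrow
    have hlw' : ((F.fe.base.row l).p : 𝓞 K) ∈ w.asIdeal := by rw [hrowp]; exact hlw
    obtain ⟨C', hC', hw'⟩ :=
      exists_code_of_natCast_mem hirr hθ h3 hpp (F.fe.base.row_check_of_mem_reg hR hrow).1 w hlw'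
    rcases hall C' hC' with hmem | ⟨ci, -, hci, hinv⟩
    · refine Or.inr (Or.inl ⟨C', hmem, ?_, ?_, hw', ?_⟩)
      · rw [code_fst_of_mem hC', hrowp]; exact hany'
      · rw [code_fst_of_mem hC', hrowp]; exact hC'
      · have hcop := F.coprime_row hK hrow
        rw [hrowp] at hcop
        exact natCast_not_mem_of_coprime w hlw hcop
    · exact absurd hX (lin_not_mem_of_invCert hθ w hw' hinv)
  · have hany' : (F.fe.primesE.any fun e => e.p == l) = true := by simpa [List.any_eq_true] using hany
    obtain ⟨hrow, hrowp⟩ := F.fe.rowE_mem hany'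
    have hpp : (F.fe.rowE l).p.Prime := F.fe.prime_of_memE hpr hrow
    have hlw' : ((F.fe.rowE l).p : 𝓞 K) ∈ w.asIdeal := by rw [hrowp]; exact hlw
    obtain ⟨C', hC', hw'⟩ := exists_code_of_natCast_mem (F.fe.irreducibleE hE) (F.fe.aeval_eta hθ hE) h3 hpp
      (F.fe.rowE_check_of_mem hE hrow).1 w hlw'
    rcases hall C' hC' with hmem | ⟨ci, -, hci, hinv⟩
    · refine Or.inr (Or.inr ⟨C', hmem, ?_, ?_, hw', ?_⟩)
      · rw [code_fst_of_mem hC', hrowp]; exact hany'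
      · rw [code_fst_of_mem hC', hrowp]; exact hC'
      · have hcop := F.coprime_rowE hK hrow
        rw [hrowp] at hcop
        exact natCast_not_mem_of_coprime w hlw hcop
    · exact absurd hY (lin_not_mem_of_invCert (F.fe.aeval_eta hθ hE) w hw' hinv)

/-- Both avatars of `x` lie in any prime containing `x`. -/
theorem avatars_mem (hθ : aeval θ (MonicCubic.poly F.fe.base.a F.fe.base.b F.fe.base.c) = 0)
    (hE : F.fe.checkCoreE = true) (hK : F.checkConst = true) {X Y : ℤ × ℤ × ℤ}
    (h : twoViewCheck F.fe.base.a F.fe.base.b F.fe.base.c F.fe.u F.fe.d F.m₁ F.m₂ X Y = true)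
    (w : HeightOneSpectrum (𝓞 K)) (hx : eltOf F hθ hE X Y ∈ w.asIdeal) :
    lin hθ X.1 X.2.1 X.2.2 ∈ w.asIdeal ∧ lin (F.fe.aeval_eta hθ hE) Y.1 Y.2.1 Y.2.2 ∈ w.asIdeal := by
  rw [← m₁_mul_eltOf hθ hE hK h, ← m₂_mul_eltOf hθ hE hK h]
  exact ⟨Ideal.mul_mem_left _ _ hx, Ideal.mul_mem_left _ _ hx⟩

/-- A rational prime below a prime containing `x`, read on the `α`-norm form of `X`. -/
theorem exists_prime_of_mem (hθ : aeval θ (MonicCubic.poly F.fe.base.a F.fe.base.b F.fe.base.c) = 0)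
    (h3 : finrank ℚ K = 3) (hE : F.fe.checkCoreE = true) {X : ℤ × ℤ × ℤ}
    (hN : normFormZ F.fe.base.a F.fe.base.b F.fe.base.c X.1 X.2.1 X.2.2 ≠ 0) {nf : List (ℕ × ℕ)}
    (hnf : (normFormZ F.fe.base.a F.fe.base.b F.fe.base.c X.1 X.2.1 X.2.2).natAbs =
      (nf.map fun pe => pe.1 ^ pe.2).prod)
    (w : HeightOneSpectrum (𝓞 K)) (hX : lin hθ X.1 X.2.1 X.2.2 ∈ w.asIdeal) :
    ∃ pe ∈ nf, (pe.1 : 𝓞 K) ∈ w.asIdeal := by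
  have hirr := F.fe.base.irreducible_of_reg (F.fe.checkReg_of_coreE hE)
  have hX0 : lin hθ X.1 X.2.1 X.2.2 ≠ 0 := lin_ne_zero_of_coords hirr hθ h3 X hN
  obtain ⟨l, hl, hldvd, hlw⟩ := exists_prime_dvd_norm_mem w hX0 hX
  rw [natAbs_norm_lin_coords hirr hθ h3, hnf] at hldvd
  obtain ⟨a, ha, hla⟩ := (Prime.dvd_prod_iff hl.prime).mp hldvd
  obtain ⟨pe, hpe, rfl⟩ := List.mem_map.mp ha
  obtain ⟨k, hk⟩ := hl.dvd_of_dvd_pow hla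
  refine ⟨pe, hpe, ?_⟩
  rw [hk, Nat.cast_mul]
  exact Ideal.mul_mem_right _ _ hlw

/-! ### The support-code clause -/

/-- The support-code clause, `α`-view branch. -/
theorem codeClause_true {bc : (Bool × PCode) × FamEntry2} (h : codeClause F cc bc = true) (hb : bc.1.1 = true) :
    (F.fe.base.primes.any fun e => e.p == bc.1.2.1) = true ∧ bc.1.2 ∈ (F.fe.base.row bc.1.2.1).codes ∧
      memCode bc.1.2 cc.XD = true := by
  unfold codeClause at h
  rw [hb] at h
  simp only [↓reduceIte, Bool.and_eq_true, decide_eq_true_eq] at h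
  exact ⟨h.1.1, h.1.2, h.2⟩

/-- The support-code clause, `η`-view branch. -/
theorem codeClause_false {bc : (Bool × PCode) × FamEntry2} (h : codeClause F cc bc = true) (hb : bc.1.1 = false) :
    (F.fe.primesE.any fun e => e.p == bc.1.2.1) = true ∧ bc.1.2 ∈ (F.fe.rowE bc.1.2.1).codes ∧
      memCode bc.1.2 cc.YD = true := by
  unfold codeClause at h
  rw [hb] at h
  simp only [Bool.false_eq_true, ↓reduceIte, Bool.and_eq_true, decide_eq_true_eq] at h
  exact ⟨h.1.1, h.1.2, h.2⟩

/-! ### Support of a family element -/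

/-- **Support**: every prime containing the family element `x` contains `M = D · q`.
[cite: Cassels1991LecturesEllipticCurves, §15] -/
theorem supp_of_famCheckE2 (hθ : aeval θ (MonicCubic.poly F.fe.base.a F.fe.base.b F.fe.base.c) = 0)
    (h3 : finrank ℚ K = 3) (hE : F.fe.checkCoreE = true) (hK : F.checkConst = true)
    (hpr : F.fe.primeListE.Forall Nat.Prime) (hcodes : ∀ bc ∈ cc.codes, codeClause F cc bc = true)
    (htvD : twoViewCheck F.fe.base.a F.fe.base.b F.fe.base.c F.fe.u F.fe.d F.m₁ F.m₂ cc.XD cc.YD = true)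
    (h : famCheckE2 F cc f = true) :
    ∀ v : HeightOneSpectrum (𝓞 K), eltOf F hθ hE f.X f.Y ∈ v.asIdeal →
      eltOf F hθ hE cc.XD cc.YD * ((F.fe.base.q : ℕ) : 𝓞 K) ∈ v.asIdeal := by
  intro v hv
  obtain ⟨hXv, hYv⟩ := avatars_mem hθ hE hK (tv_of_famCheckE2 h) v hv
  obtain ⟨pe, hpe, hpv⟩ :=
    exists_prime_of_mem hθ h3 hE (normFormZ_ne_of_famCheckE2 h) (natAbs_of_famCheckE2 h) v hXv
  rcases dispatch_sound (cc := cc) hθ h3 hE hK hpr (dispatch_of_famCheckE2 h pe hpe) v hpv hXv hYv with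
    hq | ⟨C, hmem, -, -, hw, hm₁⟩ | ⟨C, hmem, -, -, hw, hm₂⟩
  · exact Ideal.mul_mem_left _ _ hq
  · obtain ⟨bc, hbc, hbc1⟩ := List.mem_map.mp hmem
    obtain ⟨-, -, hmc⟩ := codeClause_true (hcodes bc hbc) (by rw [hbc1])
    have hC : bc.1.2 = C := by rw [hbc1]
    rw [hC] at hmc
    have hXD : lin hθ cc.XD.1 cc.XD.2.1 cc.XD.2.2 ∈ v.asIdeal := lin_mem_of_memCode hθ v hw cc.XD hmc
    exact Ideal.mul_mem_right _ _
      ((mem_iff_of_natCast_mul_eq v hm₁ (m₁_mul_eltOf hθ hE hK htvD)).mpr hXD)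
  · obtain ⟨bc, hbc, hbc1⟩ := List.mem_map.mp hmem
    obtain ⟨-, -, hmc⟩ := codeClause_false (hcodes bc hbc) (by rw [hbc1])
    have hC : bc.1.2 = C := by rw [hbc1]
    rw [hC] at hmc
    have hYD : lin (F.fe.aeval_eta hθ hE) cc.YD.1 cc.YD.2.1 cc.YD.2.2 ∈ v.asIdeal :=
      lin_mem_of_memCode (F.fe.aeval_eta hθ hE) v hw cc.YD hmc
    exact Ideal.mul_mem_right _ _
      ((mem_iff_of_natCast_mul_eq v hm₂ (m₂_mul_eltOf hθ hE hK htvD)).mpr hYD)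

/-! ### Sign, real non-vanishing -/

/-- **Sign of a checked family element at the real place** (read on `X`, as `m₁ > 0`). [folklore] -/
theorem sign_iff_of_famCheckE2 (hθ : aeval θ (MonicCubic.poly F.fe.base.a F.fe.base.b F.fe.base.c) = 0)
    (ρ : K →+* ℝ) (hlo : ((F.fe.base.lo : ℚ) : ℝ) < ρ θ) (hhi : ρ θ < ((F.fe.base.hi : ℚ) : ℝ))
    (h0 : 0 ≤ F.fe.base.lo) (hE : F.fe.checkCoreE = true) (hK : F.checkConst = true)
    (h : famCheckE2 F cc f = true) :
    (f.sg = true ↔ ρ (algebraMap (𝓞 K) K (eltOf F hθ hE f.X f.Y)) < 0) := by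
  have h1 := sign_iff_of_signCond hθ ρ h0 hlo hhi (signCond_of_famCheckE2 h)
  rw [rho_eltOf hθ hE hK (tv_of_famCheckE2 h) ρ] at h1
  have hm : (0 : ℝ) < F.m₁ := Nat.cast_pos.mpr (F.m₁_pos hK)
  rw [h1]
  constructor
  · intro hneg
    by_contra hc
    push Not at hc
    nlinarith
  · intro hneg
    exact mul_neg_of_pos_of_neg hm hneg

/-- A checked family element is non-zero at the real place. [folklore] -/
theorem rho_ne_zero_of_famCheckE2 (hθ : aeval θ (MonicCubic.poly F.fe.base.a F.fe.base.b F.fe.base.c) = 0)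
    (ρ : K →+* ℝ) (hlo : ((F.fe.base.lo : ℚ) : ℝ) < ρ θ) (hhi : ρ θ < ((F.fe.base.hi : ℚ) : ℝ))
    (h0 : 0 ≤ F.fe.base.lo) (hE : F.fe.checkCoreE = true) (hK : F.checkConst = true)
    (h : famCheckE2 F cc f = true) : ρ (algebraMap (𝓞 K) K (eltOf F hθ hE f.X f.Y)) ≠ 0 := by
  have h1 := rho_lin_ne_zero_of_signCond hθ ρ h0 hlo hhi (signCond_of_famCheckE2 h)
  rw [rho_eltOf hθ hE hK (tv_of_famCheckE2 h) ρ] at h1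
  exact (mul_ne_zero_iff.mp h1).2

end Sound

end Summit.BirchSwinnertonDyer.BirchSwinnertonDyer.Rank2Observatory.TwoDescCl

end
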